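import Mathlib
import Summits.CriticalPhenomena.Ising3DConformalLimit.Theorems.PrecisionLaplacianTwoPointSpineGlueLattice
import Literature.Probability.LatticeModels.CriticalTwoPointLower
import Literature.MathematicalPhysics.QuantumFieldTheory.MirrorRPKernel
import HarnessLib

/-!
# TwoPointSpineGlue (route PrecisionLaplacian, item stmt-CriticalPhenomena-4805) — passage of the
# lattice symmetries and of lattice reflection positivity to the limit kernel

Helper file 4 for the proof of
`Summit.CriticalPhenomena.Ising3DConformalLimit.Theses.PrecisionLaplacian.TwoPointSpineGlue`.
Let `G = criticalTwoPoint 3` and suppose `G(x) ‖x‖₂^s - U(x/‖x‖₂) → 0` at infinity on `ℤ³` for a kernel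
`U : ℝ³ → ℝ` continuous off the origin and homogeneous of degree `-s` (in the application `U = A₀⁻¹ K`,
`K` the potential kernel of the limiting stable law, `s = 3 - α = 1 + η`).  Then:

* `tendsto_rescaled` — along every lattice sequence `y_N` with `y_N / N → w ≠ 0`,
  `N^s G(y_N) → U(w)` (directional transfer, `…TwoPointSpineGlueLattice`);
* `invariant_of_latticeSymm` — `U ∘ θ_n = U` for each of the nine lattice mirrors
  `n ∈ {eᵢ, eᵢ ± eⱼ}`, because `G` is invariant under the corresponding signed coordinate permutation of
  `ℤ³` (Friedli–Velenik 2017, Exercise 3.14: `twoPointPlus_perm_invariant_holds`,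
  `twoPointPlus_reflection_invariant_holds`);
* `mirrorRP_of_latticeRP` — if `G` is reflection positive for a lattice realisation `θ'` of `θ_n` on
  finite families strictly inside the integer half-lattice `{ℓ > 0}` realising `⟪·, n⟫ > 0`, then `U` is
  a mirror-reflection-positive kernel for `n` (`IsMirrorRPKernel n U`): approximate the points by
  `⌊N p_a⌋`, eventually strictly inside the half-lattice, multiply the lattice inequality by `N^s ≥ 0`
  and pass to the limit (Glimm–Jaffe 1987, §10.4: RP is closed under limits);
* `nineMirror_of_latticeRP` — the nine-case dispatch.

No definitions are introduced.  References: J. Fröhlich, R. Israel, E. H. Lieb, B. Simon, Comm. Math.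
Phys. 62 (1978) §3; J. Glimm, A. Jaffe, *Quantum Physics* (1987) §10.4; S. Friedli, Y. Velenik (2017)
Exercise 3.14.
-/

noncomputable section

namespace Summit.CriticalPhenomena.Ising3DConformalLimit.Theorems.SpineGlue

open Filter Topology
open Literature.Probability.LatticeModels Literature.MathematicalPhysics.QuantumFieldTheory
open scoped InnerProductSpace

/-! ### Lattice symmetries of the critical two-point function of `ℤ³` -/

/-- `G` is invariant under the coordinate swap `x ↦ x ∘ swap i j` (Friedli–Velenik 2017, Exercise 3.14). -/
theorem criticalTwoPoint_comp_swap (i j : Fin 3) (x : Site 3) :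
    criticalTwoPoint 3 (x ∘ Equiv.swap i j) = criticalTwoPoint 3 x :=
  twoPointPlus_perm_invariant_holds (criticalBeta_nonneg 3) (Equiv.swap i j) x

/-- The anti-diagonal mirror `xᵢ ↦ -xⱼ, xⱼ ↦ -xᵢ` is the swap followed by the two sign flips. -/
theorem antiMirror_eq {i j : Fin 3} (hij : i ≠ j) (x : Site 3) :
    Function.update (Function.update x i (-x j)) j (-x i) =
      Function.update (Function.update (x ∘ Equiv.swap i j) i (-(x ∘ Equiv.swap i j) i)) j
        (-(Function.update (x ∘ Equiv.swap i j) i (-(x ∘ Equiv.swap i j) i)) j) := by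
  funext k
  by_cases hk : k = j
  · subst hk
    simp [Function.update_self, Function.update_of_ne (Ne.symm hij), Equiv.swap_apply_right]
  · by_cases hk' : k = i
    · subst hk'
      simp [Function.update_of_ne hk, Equiv.swap_apply_left]
    · simp [Function.update_of_ne hk, Function.update_of_ne hk',
        Equiv.swap_apply_of_ne_of_ne hk' hk]

/-- `G` is invariant under the anti-diagonal mirror `xᵢ ↦ -xⱼ, xⱼ ↦ -xᵢ`. -/
theorem criticalTwoPoint_antiMirror {i j : Fin 3} (hij : i ≠ j) (x : Site 3) :
    criticalTwoPoint 3 (Function.update (Function.update x i (-x j)) j (-x i)) = criticalTwoPoint 3 x := by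
  -- the coordinate sign flips (`twoPointPlus_reflection_invariant_holds`, Friedli–Velenik Exercise 3.14)
  have hflip : ∀ (l : Fin 3) (y : Site 3),
      criticalTwoPoint 3 (Function.update y l (-y l)) = criticalTwoPoint 3 y := fun l y =>
    twoPointPlus_reflection_invariant_holds (criticalBeta_nonneg 3) l y
  rw [antiMirror_eq hij, hflip, hflip, criticalTwoPoint_comp_swap]

/-! ### The rescaled lattice kernel along lattice sequences -/

/-- `⌊N w⌋ / N → w` for the coordinatewise-floor approximation. -/
theorem tendsto_inv_smul_latticeApprox (w : EuclideanSpace ℝ (Fin 3)) :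
    Tendsto (fun N : ℕ => (N : ℝ)⁻¹ • siteVec (latticeApprox ((N : ℝ)⁻¹) w)) atTop (𝓝 w) :=
  tendsto_inv_smul_of_norm_sub_le fun N => norm_siteVec_latticeApprox_sub_le N w

section Kernel

variable {s : ℝ} {U : EuclideanSpace ℝ (Fin 3) → ℝ}

/-- **Directional transfer for a homogeneous profile.** If `G(x)‖x‖^s - U(x̂) → 0` at infinity with `U`
continuous off `0` and homogeneous of degree `-s`, then `N^s G(y_N) → U(w)` along every lattice sequence
with `y_N / N → w ≠ 0`. -/
theorem tendsto_rescaled (hU : ContinuousOn U {0}ᶜ)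
    (hhom : ∀ c : ℝ, 0 < c → ∀ y, U (c • y) = c ^ (-s) * U y)
    (hGU : Tendsto (fun x : Site 3 => criticalTwoPoint 3 x * ‖siteVec x‖ ^ s -
      U (‖siteVec x‖⁻¹ • siteVec x)) cofinite (𝓝 0))
    {y : ℕ → Site 3} {w : EuclideanSpace ℝ (Fin 3)}
    (hy : Tendsto (fun N : ℕ => (N : ℝ)⁻¹ • siteVec (y N)) atTop (𝓝 w)) (hw : w ≠ 0) :
    Tendsto (fun N : ℕ => (N : ℝ) ^ s * criticalTwoPoint 3 (y N)) atTop (𝓝 (U w)) := by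
  have hUs : ContinuousOn U (Metric.sphere 0 1) :=
    hU.mono fun u hu => by
      simp only [Metric.mem_sphere, dist_zero_right] at hu
      simp only [Set.mem_compl_iff, Set.mem_singleton_iff]
      intro h; rw [h, norm_zero] at hu; exact zero_ne_one hu
  have h := tendsto_rpow_mul_of_directional hGU hUs hy hw
  have hval : ‖w‖ ^ (-s) * U (‖w‖⁻¹ • w) = U w := by
    have hn : 0 < ‖w‖ := norm_pos_iff.2 hw
    have h1 := hhom ‖w‖ hn (‖w‖⁻¹ • w)
    rw [smul_smul, mul_inv_cancel₀ hn.ne', one_smul] at h1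
    exact h1.symm
  rwa [hval] at h

/-- **Lattice symmetry passes to the limit kernel**: if `θ'` realises the continuum map `θ` on `ℤ³`
(`siteVec (θ' y) = θ (siteVec y)`, `θ` a linear isometry) and `G ∘ θ' = G`, then `U ∘ θ = U`. -/
theorem invariant_of_latticeSymm (hU : ContinuousOn U {0}ᶜ)
    (hhom : ∀ c : ℝ, 0 < c → ∀ y, U (c • y) = c ^ (-s) * U y)
    (hGU : Tendsto (fun x : Site 3 => criticalTwoPoint 3 x * ‖siteVec x‖ ^ s -
      U (‖siteVec x‖⁻¹ • siteVec x)) cofinite (𝓝 0))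
    (θ : EuclideanSpace ℝ (Fin 3) ≃ₗᵢ[ℝ] EuclideanSpace ℝ (Fin 3)) (θ' : Site 3 → Site 3)
    (hθ' : ∀ y, siteVec (θ' y) = θ (siteVec y)) (hG : ∀ y, criticalTwoPoint 3 (θ' y) = criticalTwoPoint 3 y)
    (w : EuclideanSpace ℝ (Fin 3)) : U (θ w) = U w := by
  by_cases hw : w = 0
  · subst hw; rw [map_zero]
  set y : ℕ → Site 3 := fun N => latticeApprox ((N : ℝ)⁻¹) w with hy
  have h1 : Tendsto (fun N : ℕ => (N : ℝ)⁻¹ • siteVec (y N)) atTop (𝓝 w) :=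
    tendsto_inv_smul_latticeApprox w
  have h2 : Tendsto (fun N : ℕ => (N : ℝ)⁻¹ • siteVec (θ' (y N))) atTop (𝓝 (θ w)) := by
    have : ∀ N : ℕ, (N : ℝ)⁻¹ • siteVec (θ' (y N)) = θ ((N : ℝ)⁻¹ • siteVec (y N)) := fun N => by
      rw [hθ', LinearIsometryEquiv.map_smul]
    simp_rw [this]
    exact (θ.continuous.tendsto w).comp h1
  have hθw : θ w ≠ 0 := fun h => hw (θ.injective (by rw [h, map_zero]))
  have l1 := tendsto_rescaled hU hhom hGU h1 hw
  have l2 := tendsto_rescaled hU hhom hGU h2 hθw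
  simp_rw [hG] at l2
  exact tendsto_nhds_unique l2 l1

/-- **Lattice reflection positivity passes to the limit kernel.** Let `n` be a normal vector, `θ'`
a map of `ℤ³` realising the mirror reflection `θ_n` on lattice sites and `ℓ` an integer level
realising `⟪·, n⟫` on lattice sites.  If `G` is reflection positive for `θ'` on finite families of sites
strictly inside `{ℓ > 0}`, then `U` is a mirror-reflection-positive kernel for `n`
(Glimm–Jaffe 1987, §10.4: RP is closed under limits). -/
theorem mirrorRP_of_latticeRP (hU : ContinuousOn U {0}ᶜ)
    (hhom : ∀ c : ℝ, 0 < c → ∀ y, U (c • y) = c ^ (-s) * U y)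
    (hGU : Tendsto (fun x : Site 3 => criticalTwoPoint 3 x * ‖siteVec x‖ ^ s -
      U (‖siteVec x‖⁻¹ • siteVec x)) cofinite (𝓝 0))
    (n : EuclideanSpace ℝ (Fin 3)) (θ' : Site 3 → Site 3) (ℓ : Site 3 → ℤ)
    (hθ' : ∀ y, siteVec (θ' y) = (ℝ ∙ n)ᗮ.reflection (siteVec y))
    (hℓ : ∀ y, (ℓ y : ℝ) = ⟪siteVec y, n⟫_ℝ)
    (hRP : ∀ (m : ℕ) (y : Fin m → Site 3) (c : Fin m → ℝ), (∀ a, 0 < ℓ (y a)) →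
      0 ≤ ∑ a, ∑ b, c a * c b * criticalTwoPoint 3 (y b - θ' (y a))) :
    IsMirrorRPKernel n U := by
  intro m p c hp
  set θ := (ℝ ∙ n)ᗮ.reflection with hθdef
  -- the points `p a - θ (p b)` are off the origin
  have hne : ∀ a b, p a - θ (p b) ≠ 0 := fun a b =>
    fun h => (inner_sub_mirrorReflection_normal_pos (hp a) (hp b)).ne' (by rw [h, inner_zero_left])
  -- the approximants
  set y : ℕ → Fin m → Site 3 := fun N a => latticeApprox ((N : ℝ)⁻¹) (p a) with hy
  have hyl : ∀ a, Tendsto (fun N : ℕ => (N : ℝ)⁻¹ • siteVec (y N a)) atTop (𝓝 (p a)) := fun a =>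
    tendsto_inv_smul_latticeApprox (p a)
  -- limits of the rescaled two-point function along `y N a - θ' (y N b)`
  have hT : ∀ a b, Tendsto (fun N : ℕ => (N : ℝ) ^ s * criticalTwoPoint 3 (y N a - θ' (y N b)))
      atTop (𝓝 (U (p a - θ (p b)))) := by
    intro a b
    refine tendsto_rescaled hU hhom hGU ?_ (hne a b)
    have : ∀ N : ℕ, (N : ℝ)⁻¹ • siteVec (y N a - θ' (y N b)) =
        (N : ℝ)⁻¹ • siteVec (y N a) - θ ((N : ℝ)⁻¹ • siteVec (y N b)) := fun N => by
      rw [siteVec_sub, smul_sub, hθ', LinearIsometryEquiv.map_smul]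
    simp_rw [this]
    exact (hyl a).sub ((θ.continuous.tendsto _).comp (hyl b))
  -- eventually every approximant is strictly inside the half-lattice
  have hpos : ∀ᶠ N : ℕ in atTop, ∀ a, 0 < ℓ (y N a) := by
    refine eventually_all.2 fun a => ?_
    have hcont : Continuous fun q : EuclideanSpace ℝ (Fin 3) => ⟪q, n⟫_ℝ :=
      continuous_id.inner continuous_const
    have ht : Tendsto (fun N : ℕ => ⟪(N : ℝ)⁻¹ • siteVec (y N a), n⟫_ℝ) atTop (𝓝 ⟪p a, n⟫_ℝ) :=
      (hcont.tendsto _).comp (hyl a)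
    filter_upwards [ht.eventually (lt_mem_nhds (hp a)), eventually_ge_atTop 1] with N hN hN1
    rw [real_inner_smul_left, ← hℓ] at hN
    have hNpos : (0 : ℝ) < (N : ℝ)⁻¹ := by positivity
    have h' : (0 : ℝ) < ℓ (y N a) := pos_of_mul_pos_right hN hNpos.le
    exact_mod_cast h'
  -- eventually the rescaled lattice sums are nonnegative
  have hsum : ∀ᶠ N : ℕ in atTop,
      0 ≤ ∑ a, ∑ b, c a * c b * ((N : ℝ) ^ s * criticalTwoPoint 3 (y N a - θ' (y N b))) := by
    filter_upwards [hpos] with N hN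
    have hlat := hRP m (y N) c hN
    have hrw : ∑ a, ∑ b, c a * c b * ((N : ℝ) ^ s * criticalTwoPoint 3 (y N a - θ' (y N b))) =
        (N : ℝ) ^ s * ∑ a, ∑ b, c a * c b * criticalTwoPoint 3 (y N b - θ' (y N a)) := by
      rw [Finset.mul_sum, Finset.sum_comm]
      refine Finset.sum_congr rfl fun a _ => ?_
      rw [Finset.mul_sum]
      refine Finset.sum_congr rfl fun b _ => ?_
      ring
    rw [hrw]
    exact mul_nonneg (Real.rpow_nonneg (Nat.cast_nonneg N) s) hlat
  -- pass to the limit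
  have hlim : Tendsto (fun N : ℕ => ∑ a, ∑ b, c a * c b *
      ((N : ℝ) ^ s * criticalTwoPoint 3 (y N a - θ' (y N b)))) atTop
      (𝓝 (∑ a, ∑ b, c a * c b * U (p a - θ (p b)))) :=
    tendsto_finsetSum _ fun a _ => tendsto_finsetSum _ fun b _ => (hT a b).const_mul _
  exact ge_of_tendsto hlim hsum

/-- **The nine lattice mirrors.** Under the two-point nine-mirror lattice reflection positivity of `G`
(the `k ≡ 1` case of `CriticalCorrNineMirrorRP`, Fröhlich–Israel–Lieb–Simon 1978, written with
`G (y_b - θ' y_a) = ⟨σ_{θ' y_a} σ_{y_b}⟩`), the limit kernel `U` is invariant and reflection positive with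
respect to each of the nine mirrors `eᵢ`, `eᵢ ± eⱼ`. -/
theorem nineMirror_of_latticeRP (hU : ContinuousOn U {0}ᶜ)
    (hhom : ∀ c : ℝ, 0 < c → ∀ y, U (c • y) = c ^ (-s) * U y)
    (hGU : Tendsto (fun x : Site 3 => criticalTwoPoint 3 x * ‖siteVec x‖ ^ s -
      U (‖siteVec x‖⁻¹ • siteVec x)) cofinite (𝓝 0))
    (hRP : ∀ (θ' : Site 3 → Site 3) (ℓ : Site 3 → ℤ),
      (∃ i j : Fin 3, i ≠ j ∧ ((θ' = fun x => Function.update x i (-x i)) ∧ (ℓ = fun x => x i) ∨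
        (θ' = fun x => x ∘ Equiv.swap i j) ∧ (ℓ = fun x => x i - x j) ∨
        (θ' = fun x => Function.update (Function.update x i (-x j)) j (-x i)) ∧
          (ℓ = fun x => x i + x j))) →
      ∀ (m : ℕ) (y : Fin m → Site 3) (c : Fin m → ℝ), (∀ a, 0 < ℓ (y a)) →
        0 ≤ ∑ a, ∑ b, c a * c b * criticalTwoPoint 3 (y b - θ' (y a)))
    {n : EuclideanSpace ℝ (Fin 3)}
    (hn : ∃ i j : Fin 3, i ≠ j ∧ (n = EuclideanSpace.single i 1 ∨
      n = EuclideanSpace.single i 1 + EuclideanSpace.single j 1 ∨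
      n = EuclideanSpace.single i 1 - EuclideanSpace.single j 1)) :
    (∀ x, U (((ℝ ∙ n)ᗮ).reflection x) = U x) ∧ IsMirrorRPKernel n U := by
  obtain ⟨i, j, hij, rfl | rfl | rfl⟩ := hn
  · have hflip : ∀ y : Site 3, criticalTwoPoint 3 (Function.update y i (-y i)) = criticalTwoPoint 3 y :=
      fun y => twoPointPlus_reflection_invariant_holds (criticalBeta_nonneg 3) i y
    refine ⟨fun x => ?_, ?_⟩
    · exact invariant_of_latticeSymm hU hhom hGU _ (fun y => Function.update y i (-y i))
        (fun y => (reflection_single_vec i y).symm) hflip x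
    · exact mirrorRP_of_latticeRP hU hhom hGU _ (fun y => Function.update y i (-y i)) (fun y => y i)
        (fun y => (reflection_single_vec i y).symm) (fun y => (inner_vec_single i y).symm)
        (hRP _ _ ⟨i, j, hij, Or.inl ⟨rfl, rfl⟩⟩)
  · refine ⟨fun x => ?_, ?_⟩
    · exact invariant_of_latticeSymm hU hhom hGU _
        (fun y => Function.update (Function.update y i (-y j)) j (-y i))
        (fun y => (reflection_single_add_vec hij y).symm) (criticalTwoPoint_antiMirror hij) x
    · exact mirrorRP_of_latticeRP hU hhom hGU _
        (fun y => Function.update (Function.update y i (-y j)) j (-y i)) (fun y => y i + y j)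
        (fun y => (reflection_single_add_vec hij y).symm) (fun y => (inner_vec_single_add i j y).symm)
        (hRP _ _ ⟨i, j, hij, Or.inr (Or.inr ⟨rfl, rfl⟩)⟩)
  · refine ⟨fun x => ?_, ?_⟩
    · exact invariant_of_latticeSymm hU hhom hGU _ (fun y => y ∘ Equiv.swap i j)
        (fun y => (reflection_single_sub_vec hij y).symm) (criticalTwoPoint_comp_swap i j) x
    · exact mirrorRP_of_latticeRP hU hhom hGU _ (fun y => y ∘ Equiv.swap i j) (fun y => y i - y j)
        (fun y => (reflection_single_sub_vec hij y).symm) (fun y => (inner_vec_single_sub i j y).symm)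
        (hRP _ _ ⟨i, j, hij, Or.inr (Or.inl ⟨rfl, rfl⟩)⟩)

end Kernel

/-! ### Constancy on the sphere of an `O(3)`-invariant kernel -/

/-- A kernel invariant under every linear isometry of `ℝ³` is constant on the unit sphere
(Cartan–Dieudonné: the reflection in `(u - e)ᗮ` maps `e` to `u`). -/
theorem const_on_sphere_of_isometry_invariant {K : EuclideanSpace ℝ (Fin 3) → ℝ}
    (hK : ∀ (R : EuclideanSpace ℝ (Fin 3) ≃ₗᵢ[ℝ] EuclideanSpace ℝ (Fin 3)) (x : EuclideanSpace ℝ (Fin 3)),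
      K (R x) = K x)
    {u e : EuclideanSpace ℝ (Fin 3)} (hu : ‖u‖ = 1) (he : ‖e‖ = 1) : K u = K e := by
  have h := Submodule.reflection_sub (show ‖e‖ = ‖u‖ by rw [hu, he])
  have := hK ((ℝ ∙ (e - u))ᗮ.reflection) e
  rw [h] at this
  exact this

end Summit.CriticalPhenomena.Ising3DConformalLimit.Theorems.SpineGlue

end
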